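import Literature.MathematicalPhysics.QuantumFieldTheory.Balaban1983to89.B9Thm312WholeLeft

/-!
# `Balaban1983to89.B9Thm312WholeH` — [B9] Theorem 3.12 (p. 423), IV: the two SUP members of (3.133) for H = GQ*(QGQ*)⁻¹ and
# H₁ = G₁Q*(QG₁Q*)⁻¹ AT ONE MEMBER, from the right ∕ left-and-right entries of G, G₁, the (3.132) letters and an H-kernel co-reading

T. Bałaban, *Propagators for lattice gauge theories in a background field*, Commun. Math. Phys. **99** (1985) 389–434
[`Balaban1985BackgroundPropagators`, "B9"]; [4] = T. Bałaban, *Propagators and renormalization transformations for lattice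
gauge theories. II*, Commun. Math. Phys. **96** (1984) 223–250 [`Balaban1984PropagatorsII`].

statement-level skeleton of published theorems with citation tags; proofs where landed; nothing here is a claim about the
Yang–Mills mass gap

THE PRINTED LOCI (verbatim).  (3.126) p. 420: *"HB = GQ*(QGQ*)⁻¹B"*; (3.129) p. 421: *"H₁B = G₁Q*(QG₁Q*)⁻¹B"*; p. 422: *"We have
|(QGQ*)⁻¹(y, y′)| ≦ O(1)(L^jη)⁻²(L^{j′}η)^{−d}e^{−δ₁d(y,y′)} for y ∈ Λ_j, y′ ∈ Λ_{j′}, (3.132) and the same for the operator with G₁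
instead of G. The above inequality together with Theorem 3.3 for G, with the exception of the inequality involving the covariant Laplace
operator in (3.42), give |H_{μν}(x, y′)|, |∇H_{μν}(x, y′)|, ‖ζ∇H(·, y′)‖_β ≦ O(1)[1, (L^jη)⁻¹, (‖ζ‖^ξ_β + |ζ|)(L^jη)^{−1−β}](L^{j′}η)^{−d}
e^{−(1/2)δ₁d(y,y′)}, for x ∈ Δ(y), or ζ ∈ C^∞₀(Δ̃(y)), y ∈ Λ_j, y′ ∈ Λ_{j′}. (3.133)"*; p. 423: *"From (3.129) and (3.132) with G₁ instead of G we
get the inequalities (3.133) for H₁"*; p. 398: *"Using Lemma 2.1 in [4] we may replace the factor (L^jη)^α by (L^jη)^β(L^{j′}η)^γ with β + γ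
= α"*; [4] (2.60) p. 234.

THE POINT.  Row 20's leaves (`…B9Thm312WholeLeaf.thm312Printed_of_step`, `…B9Thm312WholeLeafLeftGlob.thm312Printed_of_stepD`) DISPLAY the whole
of (3.133) for H, H₁ (`B9.Ineq3133 d Hk B δ U`, a reading `B9.HKernel.e ∕ .h` of the H-kernels).  The printed hence-step for its two SUP
members is in the tree over abstract seminorms (r06's `B9Ineq3133Assembly`); THIS FILE redoes it in the block-majorant currency of rows 20–21,
so that the family leaf can PROVE them from schemas: H = G∘(Q*C) is a RIGHT ENTRY of G (`…Leaf.hasMaj_right_of_step`) once G₀Q*C : Z² → 𝔠⁽²⁾ is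
bounded (letters `gQs2` ∘ `c2`), ∇_UH = ∇_UG₀Q*C + (∇_UG₀Δ′_π)(H) is a LEFT-AND-RIGHT ENTRY (`B9Thm313WholeLeft.hasMaj_left_right` pattern, here
`B9Thm312WholeLeft`-level: letters `dgQs` ∘ `c2` and `LeftStep.stepD`), the class ratio (L^jη∕L^{j′}η)² is transferred by [4] (2.60) (p. 398's
remark; cost: rate αρ and the factor L²), and the kernel reading |H(x, y′)| = |(H b)(x)| for unit test vectors b at the coarse point y′,
normalised by (L^{j′}η)^d, is the co-reading schema `CoRealizesH` (the H-analogue of `B9Thm37GlueCor36.CoRealizes`):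
* §1 `CoRealizesH Hk n U d bu bv A` (hypothesis schema on how an operator layer reads its H-kernels; nothing asserted); `LettersH 𝔬 R₀ H₀ hG B₃ δ₃ U`
  (Prop structure, printed shape: `gQs2`, `dgQs` = G₀Q*, ∇_UG₀Q* on the coarse classes; `c2`, `c12` = (3.132) for (QGQ*)⁻¹, (QG₁Q*)⁻¹ in the
  transferred classes Z² → Z⁰ — the knit's leaf `s3132`); `hk_le_of_hasMajorantHom` (majorant + co-reading ⇒ the kernel bound).
* §2 `H_entry0` (H = A∘(Q*C) : Z² → 𝔠⁽²⁾, constant B₃²c(1 − θc)⁻¹, rate ρ), `H_entry1` (∇_UH : Z² → 𝔠_Y⁽¹⁾, constant B₃²c + θ′·B₃²c(1−θc)⁻¹·c), generic in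
  (G₀, T, A, C) so that T = Δ′_π, A = G, C = (QGQ*)⁻¹ gives H and T = Δ′_π + Δ⁽²⁾_π, A = G₁, C = (QG₁Q*)⁻¹ gives H₁.
* §3 `hk_e0_of_hasMaj`, `hk_e1_of_hasMaj` (the transfer + co-reading: Hk.e 0 ≦ KL²(L^{j′}η)^{−d}e^{−(1−α)ρd}, Hk.e 1 ≦ KL²(L^jη)⁻¹(L^{j′}η)^{−d}
  e^{−(1−α)ρd}), `ineq3133_sup_of_entries` (the sup conjunct of `B9.Ineq3133` from the two, at δ₁ := 2(1−α)ρ), `ineq3133_of_parts` (`B9.Ineq3133`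
  from its sup and Hölder conjuncts at separate constants ∕ rates).
The family theorem (row 20 with (3.42)₁,₂,₃, (3.47)₀,₁,₂ AND (3.133)'s sup members PROVED INSIDE) is the sequel `…B9Thm312WholeLeafH`.

HONEST SCOPE.  Nothing of print is asserted: the letters ((3.132), Theorem 3.3's G₀Q*-entries), the steps and the co-readings are HYPOTHESES of
printed ∕ definitional shape; the Hölder member ‖ζ∇H(·,y′)‖_β of (3.133) is NOT treated (it stays displayed in the sequel).  NOT a node
discharge, NOT summit progress; one finite lattice at a time; nothing continuum, nothing about the mass gap.  Cell `pub-ymgap` (HUMAN RULING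
D-0062), Track A node N06 [B9], N06-ASSIGNMENT v1 row 20 (bundle F7), seat `pub-ymgap-dag-n06-l` (g2), 2026-08-27.
-/

namespace Literature.MathematicalPhysics.QuantumFieldTheory.Balaban1983to89.B9Thm312WholeH

open Literature.MathematicalPhysics.QuantumFieldTheory.Balaban1983to89
open Finset B6RandomWalk B6RandomWalkHom B9Thm34Ext B9Thm37GlueCor36 B11SectG B9SectDSup
open B9Thm37AllNorms B9Thm37AllNormsInstances B9FromB6 B9FromB6ModelSignsOn B9Thm312Whole B9Thm312WholeLeaf B9Thm312WholeLeft

noncomputable section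

section OneMember

variable {g : B9.Geometry} {B : B9.Backgrounds} {X Y Z W : Type}
variable [Fintype X] [Fintype Y] [Fintype Z] [Fintype g.Site]

/-! ## §1 The H-kernel co-reading and the letters (printed ∕ definitional shape; nothing asserted) -/

/-- **CO-READING OF THE n-TH SUP MEMBER OF (3.133) BY A MODEL OPERATOR** (the H-analogue of `B9Thm37GlueCor36.CoRealizes`; a hypothesis schema
on how an operator layer instantiates `B9.HKernel.e`, nothing asserted).  Print (3.133): the bounded quantity is |H_{μν}(x, y′)| (n = 0) resp.
|∇H_{μν}(x, y′)| (n = 1) for x ∈ Δ(y), the kernel of H against the coarse pairing — i.e. (L^{j′}η)^{−d} times the value at x of H applied to a unit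
test vector at the coarse point y′.  Typed: `Hk.e n U y y′` is BELOW c whenever |(A b)(x)| ≦ c·(L^{j′}η)^d for every x in the block of y and every
b on the coarse lattice `v` vanishing off the block of y′ with |b| ≦ 1 pointwise; `A` = H(U) (n = 0, target lattice the bond fields)
resp. ∇_U∘H(U) (n = 1, target lattice their covariant derivatives). [cite: Balaban1985BackgroundPropagators, (3.133) p.422 + (3.126) p.420] -/
structure CoRealizesH {u v : Type} (Hk : B9.HKernel g B) (n : Fin 2) (U : B.Cfg) (d : ℕ) (bu : u → g.Site) (bv : v → g.Site)
    (A : (v → ℝ) →ₗ[ℝ] (u → ℝ)) : Prop where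
  obs : ∀ (y y' : g.Site) (c : ℝ), 0 ≤ c →
    (∀ b : v → ℝ, (∀ x', bv x' ≠ y' → b x' = 0) → (∀ x', |b x'| ≤ 1) → ∀ x : u, bu x = y → |A b x| ≤ c * (g.len y') ^ (d : ℝ)) →
      Hk.e n U y y' ≤ c

/-- **THE LETTERS OF (3.133)'s REDUCTION AT U** (hypotheses of printed shape between the state norms; nothing asserted): `gQs2` = the H₀-type entry
G₀Q* of Theorem 3.3's G₀, |(G₀Q*b)(x)| ≦ B₃(L^jη)²e^{−δ₃d}|b| (classes Z⁰ → 2; = `B9Thm313Whole.Letters313.gQs2`); `dgQs` = ∇_UG₀Q*, |(∇_UG₀Q*b)(x)| ≦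
B₃L^jη·e^{−δ₃d}|b| (Z⁰ → 𝔠_Y⁽¹⁾; = `B9Thm313WholeLeft.Letters313D.dgQs`); `c2`, `c12` = (3.132) for (QGQ*)⁻¹ and (QG₁Q*)⁻¹ in the transferred classes,
|((QGQ*)⁻¹b)|_y ≦ B₃(L^{j′}η)⁻²e^{−δ₃d}|b| (Z² → Z⁰; `c12` = `Letters313.c1_2`) — the knit's leaf `s3132` read between block norms.
[cite: Balaban1985BackgroundPropagators, (3.132) p.422 + (3.126) p.420 + (3.129) p.421 + Thm 3.3 p.399 + p.398 (remark after (3.47))] -/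
structure LettersH (𝔬 : Ops g B X Y Z W) (R₀ : ℝ) (H₀ : Prop) (hG : GeoOK g) (B₃ δ₃ : ℝ) (U : B.Cfg) : Prop where
  gQs2 : HasMaj (cNorm R₀ H₀ 𝔬.blkZ hG.lenle 0) (cNorm R₀ H₀ 𝔬.blk hG.lenle 2) (𝔬.G0 U ∘ₗ 𝔬.Qstar U)
    (fun a b => B₃ * Real.exp (-(δ₃ * g.dist a b)))
  dgQs : HasMaj (cNorm R₀ H₀ 𝔬.blkZ hG.lenle 0) (cNorm R₀ H₀ 𝔬.blkY hG.lenle 1) (𝔬.D U ∘ₗ 𝔬.G0 U ∘ₗ 𝔬.Qstar U)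
    (fun a b => B₃ * Real.exp (-(δ₃ * g.dist a b)))
  c2 : HasMaj (cNorm R₀ H₀ 𝔬.blkZ hG.lenle 2) (cNorm R₀ H₀ 𝔬.blkZ hG.lenle 0) (𝔬.C U)
    (fun a b => B₃ * Real.exp (-(δ₃ * g.dist a b)))
  c12 : HasMaj (cNorm R₀ H₀ 𝔬.blkZ hG.lenle 2) (cNorm R₀ H₀ 𝔬.blkZ hG.lenle 0) (𝔬.C1 U)
    (fun a b => B₃ * Real.exp (-(δ₃ * g.dist a b)))

omit [Fintype X] [Fintype Y] [Fintype Z] in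
/-- **[4]-(2.51) majorant + H-co-reading ⇒ the kernel bound**: if A has the two-space majorant K′ ≧ 0 and `Hk.e n` is co-read by A, then
`Hk.e n U y y′ ≦ K′(y, y′)·(L^{j′}η)^{−d}` (L^{j′}η > 0). [cite: Balaban1985BackgroundPropagators, (3.133) p.422; Balaban1984PropagatorsII, (2.51) p.232] -/
theorem hk_le_of_hasMajorantHom {u v : Type} {Hk : B9.HKernel g B} {n : Fin 2} {U : B.Cfg} {d : ℕ} {bu : u → g.Site}
    {bv : v → g.Site} {A : (v → ℝ) →ₗ[ℝ] (u → ℝ)} {R₀ : ℝ} {H₀ : Prop} (hC : CoRealizesH Hk n U d bu bv A)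
    (hlen : ∀ y : g.Site, 0 < g.len y) {K' : g.Site → g.Site → ℝ} (hK' : ∀ a b, 0 ≤ K' a b)
    (hA : HasMajorantHom (g := toB6 g R₀ H₀) bv bu A K') (y y' : g.Site) :
    Hk.e n U y y' ≤ K' y y' * (g.len y') ^ (-(d : ℝ)) := by
  refine hC.obs y y' _ (mul_nonneg (hK' y y') (Real.rpow_nonneg (hlen y').le _)) fun b hoff hb x hx => ?_
  have hbs : BlockSupp (g := toB6 g R₀ H₀) bv b y' 1 := ⟨zero_le_one, fun x' _ => hb x', hoff⟩
  have h := hA y' b 1 hbs x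
  rw [hx, mul_one] at h
  calc |A b x| ≤ K' y y' := h
    _ = K' y y' * (g.len y') ^ (-(d : ℝ)) * (g.len y') ^ (d : ℝ) := by
        rw [mul_assoc, ← Real.rpow_add (hlen y'), neg_add_cancel, Real.rpow_zero, mul_one]

/-! ## §2 One member, one U: H and ∇_UH as entries of G -/

omit [Fintype Y] in
/-- **H = A∘(Q*C) AS A RIGHT ENTRY OF A = G (OR G₁)**: G₀Q* : Z⁰ → 𝔠⁽²⁾ (B₃e^{−δ₃d}) after C : Z² → Z⁰ (B₃e^{−δ₃d}) gives G₀Q*C : Z² → 𝔠⁽²⁾ (B₃²c·e^{−ρd},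
ρ + σ ≦ δ₃), and the Neumann bound of `…Leaf.hasMaj_right_of_step` (step on 𝔠⁽²⁾ with θe^{−δ_K d}, θc < 1, ρ + σ ≦ δ_K, A = G₀ + G₀TA) gives
A∘(Q*C) : Z² → 𝔠⁽²⁾ the majorant B₃²c(1 − θc)⁻¹e^{−ρd} — by (3.126) ∕ (3.129) this is H ∕ H₁.
[cite: Balaban1985BackgroundPropagators, (3.126) p.420 + (3.129) p.421 + (3.132) p.422 + (3.130) p.421; Balaban1984PropagatorsII, Lemma 2.1 p.234] -/
theorem H_entry0 {R₀ : ℝ} {H₀ : Prop} (hG : GeoOK g) {blk : X → g.Site} {blkZ : Z → g.Site} {G0 T A : Module.End ℝ (X → ℝ)}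
    {Qs : (Z → ℝ) →ₗ[ℝ] (X → ℝ)} {Cop : Module.End ℝ (Z → ℝ)} {θ B₃ δ₃ δK ρ σ c : ℝ} (hrow : RowSum (toB6 g R₀ H₀) σ c)
    (hc : 0 ≤ c) (hθ : 0 ≤ θ) (hB₃ : 0 ≤ B₃) (hσ : 0 ≤ σ) (hρ : 0 ≤ ρ) (hρ₃ : ρ + σ ≤ δ₃) (hρδ : ρ + σ ≤ δK)
    (hK : HasMaj (cNorm R₀ H₀ blk hG.lenle 2) (cNorm R₀ H₀ blk hG.lenle 2) (G0 ∘ₗ T) (fun a b => θ * Real.exp (-(δK * g.dist a b))))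
    (hQs : HasMaj (cNorm R₀ H₀ blkZ hG.lenle 0) (cNorm R₀ H₀ blk hG.lenle 2) (G0 ∘ₗ Qs) (fun a b => B₃ * Real.exp (-(δ₃ * g.dist a b))))
    (hCop : HasMaj (cNorm R₀ H₀ blkZ hG.lenle 2) (cNorm R₀ H₀ blkZ hG.lenle 0) Cop (fun a b => B₃ * Real.exp (-(δ₃ * g.dist a b))))
    (hfix : A = G0 + G0 ∘ₗ T ∘ₗ A) (hq : θ * c < 1) :
    HasMaj (cNorm R₀ H₀ blkZ hG.lenle 2) (cNorm R₀ H₀ blk hG.lenle 2) (A ∘ₗ (Qs ∘ₗ Cop))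
      (fun a b => B₃ * B₃ * c * (1 - θ * c)⁻¹ * Real.exp (-(ρ * g.dist a b))) := by
  have htri : Triangle254 (toB6 g R₀ H₀) := fun a b c => hG.tri a b c
  have hS : HasMaj (cNorm R₀ H₀ blkZ hG.lenle 2) (cNorm R₀ H₀ blk hG.lenle 2) (G0 ∘ₗ (Qs ∘ₗ Cop))
      (fun a b => (cNorm R₀ H₀ blkZ hG.lenle 0 (X := Z)).κ * B₃ * B₃ * c * Real.exp (-(ρ * g.dist a b))) :=
    hasMaj_comp_exp htri hG.dnn hrow hB₃ hB₃ hρ (by linarith) hρ₃ hQs hCop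
  simp only [cNorm_κ, one_mul] at hS
  exact hasMaj_right_of_step hG hrow hθ (mul_nonneg (mul_nonneg hB₃ hB₃) hc) hρ le_rfl hρδ hK hS hfix hq

/-- **∇_UH = ∇_UA∘(Q*C) AS A LEFT-AND-RIGHT ENTRY**: ∇_UA𝒳 = ∇_UG₀𝒳 + (∇_UG₀T)(A𝒳) (`comp_fix_left` with 𝒳 = Q*C on the right) with ∇_UG₀Q*C : Z² →
𝔠_Y⁽¹⁾ (B₃²c·e^{−ρd} from `dgQs` ∘ `c2`), the derivative step ∇_UG₀T : 𝔠⁽²⁾ → 𝔠_Y⁽¹⁾ (θ′e^{−δ_K d}, `LeftStep.stepD`) and `H_entry0`: majorant (B₃²c +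
θ′·B₃²c(1 − θc)⁻¹·c)·e^{−ρd}. [cite: Balaban1985BackgroundPropagators, (3.133) p.422 + (3.126) p.420 + (3.130) p.421; Balaban1984PropagatorsII, Lemma 2.1 p.234] -/
theorem H_entry1 {R₀ : ℝ} {H₀ : Prop} (hG : GeoOK g) {blk : X → g.Site} {blkY : Y → g.Site} {blkZ : Z → g.Site}
    {G0 T A : Module.End ℝ (X → ℝ)} {Dop : (X → ℝ) →ₗ[ℝ] (Y → ℝ)} {Qs : (Z → ℝ) →ₗ[ℝ] (X → ℝ)} {Cop : Module.End ℝ (Z → ℝ)}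
    {θ θ' B₃ δ₃ δK ρ σ c : ℝ} (hrow : RowSum (toB6 g R₀ H₀) σ c)
    (hc : 0 ≤ c) (hθ : 0 ≤ θ) (hθ' : 0 ≤ θ') (hB₃ : 0 ≤ B₃) (hσ : 0 ≤ σ) (hρ : 0 ≤ ρ) (hρ₃ : ρ + σ ≤ δ₃) (hρδ : ρ + σ ≤ δK)
    (hK : HasMaj (cNorm R₀ H₀ blk hG.lenle 2) (cNorm R₀ H₀ blk hG.lenle 2) (G0 ∘ₗ T) (fun a b => θ * Real.exp (-(δK * g.dist a b))))
    (hKD : HasMaj (cNorm R₀ H₀ blk hG.lenle 2) (cNorm R₀ H₀ blkY hG.lenle 1) (Dop ∘ₗ G0 ∘ₗ T)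
      (fun a b => θ' * Real.exp (-(δK * g.dist a b))))
    (hQs : HasMaj (cNorm R₀ H₀ blkZ hG.lenle 0) (cNorm R₀ H₀ blk hG.lenle 2) (G0 ∘ₗ Qs) (fun a b => B₃ * Real.exp (-(δ₃ * g.dist a b))))
    (hDQs : HasMaj (cNorm R₀ H₀ blkZ hG.lenle 0) (cNorm R₀ H₀ blkY hG.lenle 1) (Dop ∘ₗ G0 ∘ₗ Qs)
      (fun a b => B₃ * Real.exp (-(δ₃ * g.dist a b))))
    (hCop : HasMaj (cNorm R₀ H₀ blkZ hG.lenle 2) (cNorm R₀ H₀ blkZ hG.lenle 0) Cop (fun a b => B₃ * Real.exp (-(δ₃ * g.dist a b))))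
    (hfix : A = G0 + G0 ∘ₗ T ∘ₗ A) (hq : θ * c < 1) :
    HasMaj (cNorm R₀ H₀ blkZ hG.lenle 2) (cNorm R₀ H₀ blkY hG.lenle 1) (Dop ∘ₗ A ∘ₗ (Qs ∘ₗ Cop))
      (fun a b => (B₃ * B₃ * c + θ' * (B₃ * B₃ * c * (1 - θ * c)⁻¹) * c) * Real.exp (-(ρ * g.dist a b))) := by
  have htri : Triangle254 (toB6 g R₀ H₀) := fun a b c => hG.tri a b c
  have hq1 : 0 ≤ (1 - θ * c)⁻¹ := inv_nonneg.mpr (by linarith)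
  have hB : 0 ≤ B₃ * B₃ * c := mul_nonneg (mul_nonneg hB₃ hB₃) hc
  have hH := H_entry0 hG hrow hc hθ hB₃ hσ hρ hρ₃ hρδ hK hQs hCop hfix hq
  have hEF : HasMaj (cNorm R₀ H₀ blkZ hG.lenle 2) (cNorm R₀ H₀ blkY hG.lenle 1) ((Dop ∘ₗ G0 ∘ₗ Qs) ∘ₗ Cop)
      (fun a b => (cNorm R₀ H₀ blkZ hG.lenle 0 (X := Z)).κ * B₃ * B₃ * c * Real.exp (-(ρ * g.dist a b))) :=
    hasMaj_comp_exp htri hG.dnn hrow hB₃ hB₃ hρ (by linarith) hρ₃ hDQs hCop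
  simp only [cNorm_κ, one_mul] at hEF
  have hEF' : HasMaj (cNorm R₀ H₀ blkZ hG.lenle 2) (cNorm R₀ H₀ blkY hG.lenle 1) (Dop ∘ₗ G0 ∘ₗ (Qs ∘ₗ Cop))
      (fun a b => B₃ * B₃ * c * Real.exp (-(ρ * g.dist a b))) := hEF.congr fun b => rfl
  -- ∇A𝒳 = ∇G₀𝒳 + (∇G₀T)(A𝒳), one composition
  have h2 : HasMaj (cNorm R₀ H₀ blkZ hG.lenle 2) (cNorm R₀ H₀ blkY hG.lenle 1) ((Dop ∘ₗ G0 ∘ₗ T) ∘ₗ (A ∘ₗ (Qs ∘ₗ Cop)))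
      (fun y y' => (cNorm R₀ H₀ blk hG.lenle 2 (X := X)).κ * θ' * (B₃ * B₃ * c * (1 - θ * c)⁻¹) * c *
        Real.exp (-(ρ * g.dist y y'))) :=
    hasMaj_comp_exp htri hG.dnn hrow hθ' (mul_nonneg hB hq1) hρ le_rfl hρδ hKD hH
  simp only [cNorm_κ, one_mul] at h2
  have hsum := hEF'.add h2
  have e : Dop ∘ₗ A ∘ₗ (Qs ∘ₗ Cop) = Dop ∘ₗ G0 ∘ₗ (Qs ∘ₗ Cop) + (Dop ∘ₗ G0 ∘ₗ T) ∘ₗ (A ∘ₗ (Qs ∘ₗ Cop)) := by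
    refine LinearMap.ext fun v => ?_
    have hpt : A (Qs (Cop v)) = G0 (Qs (Cop v)) + G0 (T (A (Qs (Cop v)))) := by
      conv_lhs => rw [hfix]
      simp only [LinearMap.add_apply, LinearMap.comp_apply]
    simp only [LinearMap.comp_apply, LinearMap.add_apply]
    conv_lhs => rw [hpt]
    rw [map_add]
  rw [← e] at hsum
  exact hsum.mono fun y y' => le_of_eq (by ring)

/-! ## §3 The transfer of the class ratio and the co-reading: the two sup members of (3.133) -/

omit [Fintype Y] in
/-- **(3.133), MEMBER n = 0, FROM THE ENTRY AND THE CO-READING**: H : Z² → 𝔠⁽²⁾ with Ke^{−ρd} reads back as |(Hb)(x)| ≦ K(L^jη∕L^{j′}η)²e^{−ρd}|b|; the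
class ratio is transferred by [4] (2.60) in the form `ScaleTransfer g ρ α Λ (L^{·}η)²` (p. 398's remark: (L^jη)² ≦ Λe^{αρd(y,y′)}(L^{j′}η)², Λ = L²
under 2·log L ≦ αρRM; d symmetric), and the co-reading gives `Hk.e 0 U y y′ ≦ K·Λ·(L^{j′}η)^{−d}·e^{−(1−α)ρd(y,y′)}`.
[cite: Balaban1985BackgroundPropagators, (3.133) p.422 + p.398 (remark after (3.47)); Balaban1984PropagatorsII, (2.60) p.234] -/
theorem hk_e0_of_hasMaj {R₀ : ℝ} {H₀ : Prop} (hG : GeoOK g) {Hk : B9.HKernel g B} {U : B.Cfg} {d : ℕ} {blk : X → g.Site}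
    {blkZ : Z → g.Site} {Hop : (Z → ℝ) →ₗ[ℝ] (X → ℝ)} {K ρ α Λ : ℝ} (hK0 : 0 ≤ K) (hΛ : 0 ≤ Λ)
    (hC : CoRealizesH Hk 0 U d blk blkZ Hop)
    (hST : B9Ineq347.ScaleTransfer g ρ α Λ (fun y => g.len y ^ (2 : ℝ)))
    (hH : HasMaj (cNorm R₀ H₀ blkZ hG.lenle 2) (cNorm R₀ H₀ blk hG.lenle 2) Hop (fun a b => K * Real.exp (-(ρ * g.dist a b)))) :
    ∀ y y' : g.Site, Hk.e 0 U y y' ≤ K * Λ * (g.len y') ^ (-(d : ℝ)) * Real.exp (-((1 - α) * ρ * g.dist y y')) := by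
  intro y y'
  have h' := hasMajorantHom_of_hasMaj_cNorm hG (fun a b => mul_nonneg hK0 (Real.exp_nonneg _)) hH
  -- the majorant read back: K e^{−ρd}(L^jη)²(L^{j′}η)⁻², bounded by KΛe^{−(1−α)ρd} after the transfer
  have hbound : ∀ a b : g.Site, K * Real.exp (-(ρ * g.dist a b)) * g.len a ^ 2 * wt g 2 b ≤
      K * Λ * Real.exp (-((1 - α) * ρ * g.dist a b)) := by
    intro a b
    have hb : 0 < g.len b := hG.lenpos b
    have ht := hST b a
    rw [hG.symm b a] at ht
    have hsplit : Real.exp (-((1 - α) * ρ * g.dist a b)) = Real.exp (-(ρ * g.dist a b)) * Real.exp (α * ρ * g.dist a b) := by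
      rw [← Real.exp_add]; congr 1; ring
    have h2 : g.len a ^ 2 * wt g 2 b ≤ Λ * Real.exp (α * ρ * g.dist a b) := by
      have hw : wt g 2 b = (g.len b ^ (2 : ℝ))⁻¹ := by simp [wt]
      rw [hw, ← Real.rpow_two, ← div_eq_mul_inv, div_le_iff₀ (Real.rpow_pos_of_pos hb _)]
      have hexp : 0 < Real.exp (-(α * ρ * g.dist a b)) := Real.exp_pos _
      have := mul_le_mul_of_nonneg_left ht (Real.exp_pos (α * ρ * g.dist a b)).le
      calc g.len a ^ (2 : ℝ) = Real.exp (α * ρ * g.dist a b) * (Real.exp (-(α * ρ * g.dist a b)) * g.len a ^ (2 : ℝ)) := by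
            rw [← mul_assoc, ← Real.exp_add, add_neg_cancel, Real.exp_zero, one_mul]
        _ ≤ Real.exp (α * ρ * g.dist a b) * (Λ * g.len b ^ (2 : ℝ)) := this
        _ = Λ * Real.exp (α * ρ * g.dist a b) * g.len b ^ (2 : ℝ) := by ring
    calc K * Real.exp (-(ρ * g.dist a b)) * g.len a ^ 2 * wt g 2 b
        = K * Real.exp (-(ρ * g.dist a b)) * (g.len a ^ 2 * wt g 2 b) := by ring
      _ ≤ K * Real.exp (-(ρ * g.dist a b)) * (Λ * Real.exp (α * ρ * g.dist a b)) :=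
          mul_le_mul_of_nonneg_left h2 (mul_nonneg hK0 (Real.exp_nonneg _))
      _ = K * Λ * Real.exp (-((1 - α) * ρ * g.dist a b)) := by rw [hsplit]; ring
  have hA := hasMajorantHom_mono (g := toB6 g R₀ H₀) blkZ blk h' hbound
  have h := hk_le_of_hasMajorantHom hC hG.lenpos (fun a b => mul_nonneg (mul_nonneg hK0 hΛ) (Real.exp_nonneg _)) hA y y'
  calc Hk.e 0 U y y' ≤ K * Λ * Real.exp (-((1 - α) * ρ * g.dist y y')) * (g.len y') ^ (-(d : ℝ)) := h
    _ = K * Λ * (g.len y') ^ (-(d : ℝ)) * Real.exp (-((1 - α) * ρ * g.dist y y')) := by ring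

/-- **(3.133), MEMBER n = 1**: ∇_UH : Z² → 𝔠_Y⁽¹⁾ with Ke^{−ρd} reads back as |(∇_UHb)(x)| ≦ K·L^jη·(L^{j′}η)⁻²e^{−ρd}|b| = K(L^jη)⁻¹(L^jη∕L^{j′}η)²…, and after the
transfer and the co-reading `Hk.e 1 U y y′ ≦ K·Λ·(L^jη)⁻¹(L^{j′}η)^{−d}·e^{−(1−α)ρd(y,y′)}`.
[cite: Balaban1985BackgroundPropagators, (3.133) p.422 + p.398 (remark after (3.47)); Balaban1984PropagatorsII, (2.60) p.234] -/
theorem hk_e1_of_hasMaj {R₀ : ℝ} {H₀ : Prop} (hG : GeoOK g) {Hk : B9.HKernel g B} {U : B.Cfg} {d : ℕ} {blkY : Y → g.Site}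
    {blkZ : Z → g.Site} {DHop : (Z → ℝ) →ₗ[ℝ] (Y → ℝ)} {K ρ α Λ : ℝ} (hK0 : 0 ≤ K) (hΛ : 0 ≤ Λ)
    (hC : CoRealizesH Hk 1 U d blkY blkZ DHop)
    (hST : B9Ineq347.ScaleTransfer g ρ α Λ (fun y => g.len y ^ (2 : ℝ)))
    (hH : HasMaj (cNorm R₀ H₀ blkZ hG.lenle 2) (cNorm R₀ H₀ blkY hG.lenle 1) DHop (fun a b => K * Real.exp (-(ρ * g.dist a b)))) :
    ∀ y y' : g.Site, Hk.e 1 U y y' ≤ K * Λ * (g.len y)⁻¹ * (g.len y') ^ (-(d : ℝ)) * Real.exp (-((1 - α) * ρ * g.dist y y')) := by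
  intro y y'
  have h' := hasMajorantHom_of_hasMaj_cNorm hG (fun a b => mul_nonneg hK0 (Real.exp_nonneg _)) hH
  have hbound : ∀ a b : g.Site, K * Real.exp (-(ρ * g.dist a b)) * g.len a ^ 1 * wt g 2 b ≤
      K * Λ * (g.len a)⁻¹ * Real.exp (-((1 - α) * ρ * g.dist a b)) := by
    intro a b
    have ha : 0 < g.len a := hG.lenpos a
    have hb : 0 < g.len b := hG.lenpos b
    have ht := hST b a
    rw [hG.symm b a] at ht
    have hsplit : Real.exp (-((1 - α) * ρ * g.dist a b)) = Real.exp (-(ρ * g.dist a b)) * Real.exp (α * ρ * g.dist a b) := by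
      rw [← Real.exp_add]; congr 1; ring
    have h2 : g.len a ^ 2 * wt g 2 b ≤ Λ * Real.exp (α * ρ * g.dist a b) := by
      have hw : wt g 2 b = (g.len b ^ (2 : ℝ))⁻¹ := by simp [wt]
      rw [hw, ← Real.rpow_two, ← div_eq_mul_inv, div_le_iff₀ (Real.rpow_pos_of_pos hb _)]
      have := mul_le_mul_of_nonneg_left ht (Real.exp_pos (α * ρ * g.dist a b)).le
      calc g.len a ^ (2 : ℝ) = Real.exp (α * ρ * g.dist a b) * (Real.exp (-(α * ρ * g.dist a b)) * g.len a ^ (2 : ℝ)) := by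
            rw [← mul_assoc, ← Real.exp_add, add_neg_cancel, Real.exp_zero, one_mul]
        _ ≤ Real.exp (α * ρ * g.dist a b) * (Λ * g.len b ^ (2 : ℝ)) := this
        _ = Λ * Real.exp (α * ρ * g.dist a b) * g.len b ^ (2 : ℝ) := by ring
    have h1 : g.len a ^ 1 * wt g 2 b = (g.len a)⁻¹ * (g.len a ^ 2 * wt g 2 b) := by
      rw [pow_one]; field_simp
    calc K * Real.exp (-(ρ * g.dist a b)) * g.len a ^ 1 * wt g 2 b
        = K * Real.exp (-(ρ * g.dist a b)) * (g.len a)⁻¹ * (g.len a ^ 2 * wt g 2 b) := by rw [mul_assoc (K * _), h1, ← mul_assoc]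
      _ ≤ K * Real.exp (-(ρ * g.dist a b)) * (g.len a)⁻¹ * (Λ * Real.exp (α * ρ * g.dist a b)) :=
          mul_le_mul_of_nonneg_left h2 (mul_nonneg (mul_nonneg hK0 (Real.exp_nonneg _)) (inv_nonneg.mpr ha.le))
      _ = K * Λ * (g.len a)⁻¹ * Real.exp (-((1 - α) * ρ * g.dist a b)) := by rw [hsplit]; ring
  have hA := hasMajorantHom_mono (g := toB6 g R₀ H₀) blkZ blkY h' hbound
  have h := hk_le_of_hasMajorantHom hC hG.lenpos
    (fun a b => mul_nonneg (mul_nonneg (mul_nonneg hK0 hΛ) (inv_nonneg.mpr (hG.lenpos a).le)) (Real.exp_nonneg _)) hA y y'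
  calc Hk.e 1 U y y' ≤ K * Λ * (g.len y)⁻¹ * Real.exp (-((1 - α) * ρ * g.dist y y')) * (g.len y') ^ (-(d : ℝ)) := h
    _ = K * Λ * (g.len y)⁻¹ * (g.len y') ^ (-(d : ℝ)) * Real.exp (-((1 - α) * ρ * g.dist y y')) := by ring

omit [Fintype X] [Fintype Y] [Fintype Z] [Fintype g.Site] in
/-- **The sup conjunct of `B9.Ineq3133` from its two members**, with one constant C above both and the rate written as δ₁∕2 (δ₁ := 2(1−α)ρ).
[cite: Balaban1985BackgroundPropagators, (3.133) p.422 (bookkeeping)] -/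
theorem ineq3133_sup_of_entries (hlen : ∀ y : g.Site, 0 < g.len y) {Hk : B9.HKernel g B} {U : B.Cfg} {d : ℕ} {C₀ C₁ C τ : ℝ}
    (hC₀ : C₀ ≤ C) (hC₁ : C₁ ≤ C)
    (h0 : ∀ y y' : g.Site, Hk.e 0 U y y' ≤ C₀ * (g.len y') ^ (-(d : ℝ)) * Real.exp (-(τ * g.dist y y')))
    (h1 : ∀ y y' : g.Site, Hk.e 1 U y y' ≤ C₁ * (g.len y)⁻¹ * (g.len y') ^ (-(d : ℝ)) * Real.exp (-(τ * g.dist y y'))) :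
    ∀ (n : Fin 2) (y y' : g.Site),
      Hk.e n U y y' ≤ C * (g.len y) ^ (-(n : ℝ)) * (g.len y') ^ (-(d : ℝ)) * Real.exp (-((2 * τ) / 2 * g.dist y y')) := by
  intro n y y'
  have hτ : (2 * τ) / 2 = τ := by ring
  rw [hτ]
  have hd : 0 ≤ (g.len y') ^ (-(d : ℝ)) := Real.rpow_nonneg (hlen y').le _
  fin_cases n
  · have e : (g.len y) ^ (-((((0 : Fin 2) : ℕ) : ℝ))) = 1 := by simp
    calc Hk.e 0 U y y' ≤ C₀ * (g.len y') ^ (-(d : ℝ)) * Real.exp (-(τ * g.dist y y')) := h0 y y'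
      _ ≤ C * (g.len y') ^ (-(d : ℝ)) * Real.exp (-(τ * g.dist y y')) :=
          mul_le_mul_of_nonneg_right (mul_le_mul_of_nonneg_right hC₀ hd) (Real.exp_nonneg _)
      _ = C * (g.len y) ^ (-((((0 : Fin 2) : ℕ) : ℝ))) * (g.len y') ^ (-(d : ℝ)) * Real.exp (-(τ * g.dist y y')) := by
          rw [e, mul_one]
  · have e : (g.len y) ^ (-((((1 : Fin 2) : ℕ) : ℝ))) = (g.len y)⁻¹ := by simp [Real.rpow_neg_one]
    have hi : 0 ≤ (g.len y)⁻¹ := inv_nonneg.mpr (hlen y).le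
    calc Hk.e 1 U y y' ≤ C₁ * (g.len y)⁻¹ * (g.len y') ^ (-(d : ℝ)) * Real.exp (-(τ * g.dist y y')) := h1 y y'
      _ ≤ C * (g.len y)⁻¹ * (g.len y') ^ (-(d : ℝ)) * Real.exp (-(τ * g.dist y y')) :=
          mul_le_mul_of_nonneg_right (mul_le_mul_of_nonneg_right (mul_le_mul_of_nonneg_right hC₁ hi) hd) (Real.exp_nonneg _)
      _ = C * (g.len y) ^ (-((((1 : Fin 2) : ℕ) : ℝ))) * (g.len y') ^ (-(d : ℝ)) * Real.exp (-(τ * g.dist y y')) := by rw [e]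


omit [Fintype X] [Fintype Y] [Fintype Z] [Fintype g.Site] in
/-- **`B9.Ineq3133` assembled from its sup conjunct and its Hölder conjunct at separate constants ∕ rates**, brought to one constant C′ ≧ C
and one rate δ′ ≦ min(δ_a, δ_b) under the sign facts (L^jη > 0, d ≧ 0, cutH ≧ 0, C(β) ≧ 0) — «of course with different constants».
[cite: Balaban1985BackgroundPropagators, (3.133) p.422 + p.423 (bookkeeping)] -/
theorem ineq3133_of_parts {P : g.Loc → Prop} (S : ModelSignsOn g P) (d : ℕ) {Hk : B9.HKernel g B} {U : B.Cfg} {C C' δa δb δ' : ℝ}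
    {Cβ : ℝ → ℝ} (hlen : ∀ y : g.Site, 0 < g.len y) (hC : C ≤ C') (hC0 : 0 ≤ C) (hCβ : ∀ β, 0 ≤ Cβ β) (hδa : δ' ≤ δa)
    (hδb : δ' ≤ δb)
    (hsup : ∀ (n : Fin 2) (y y' : g.Site),
      Hk.e n U y y' ≤ C * (g.len y) ^ (-(n : ℝ)) * (g.len y') ^ (-(d : ℝ)) * Real.exp (-(δa / 2 * g.dist y y')))
    (hhol : ∀ (β : ℝ) (ζ : g.Cut) (y y' : g.Site), 0 ≤ β → β < 1 → g.cutInT ζ y →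
      Hk.h U β ζ y' ≤ Cβ β * g.cutH β ζ * (g.len y) ^ (-(1 + β)) * (g.len y') ^ (-(d : ℝ)) *
        Real.exp (-(δb / 2 * g.dist y y'))) :
    B9.Ineq3133 d Hk C' Cβ δ' U := by
  refine ⟨fun n y y' => ?_, fun β ζ y y' h0 h1 hζ => ?_⟩
  · have hexp : Real.exp (-(δa / 2 * g.dist y y')) ≤ Real.exp (-(δ' / 2 * g.dist y y')) :=
      Real.exp_le_exp.mpr (neg_le_neg (mul_le_mul_of_nonneg_right (by linarith) (S.dist_nonneg y y')))
    have h1 : 0 ≤ (g.len y) ^ (-(n : ℝ)) := Real.rpow_nonneg (hlen y).le _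
    have h2 : 0 ≤ (g.len y') ^ (-(d : ℝ)) := Real.rpow_nonneg (hlen y').le _
    calc Hk.e n U y y' ≤ C * (g.len y) ^ (-(n : ℝ)) * (g.len y') ^ (-(d : ℝ)) * Real.exp (-(δa / 2 * g.dist y y')) := hsup n y y'
      _ ≤ C * (g.len y) ^ (-(n : ℝ)) * (g.len y') ^ (-(d : ℝ)) * Real.exp (-(δ' / 2 * g.dist y y')) :=
          mul_le_mul_of_nonneg_left hexp (mul_nonneg (mul_nonneg hC0 h1) h2)
      _ ≤ C' * (g.len y) ^ (-(n : ℝ)) * (g.len y') ^ (-(d : ℝ)) * Real.exp (-(δ' / 2 * g.dist y y')) :=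
          mul_le_mul_of_nonneg_right (mul_le_mul_of_nonneg_right (mul_le_mul_of_nonneg_right hC h1) h2) (Real.exp_nonneg _)
  · have hexp : Real.exp (-(δb / 2 * g.dist y y')) ≤ Real.exp (-(δ' / 2 * g.dist y y')) :=
      Real.exp_le_exp.mpr (neg_le_neg (mul_le_mul_of_nonneg_right (by linarith) (S.dist_nonneg y y')))
    have hpre : 0 ≤ Cβ β * g.cutH β ζ * (g.len y) ^ (-(1 + β)) * (g.len y') ^ (-(d : ℝ)) :=
      mul_nonneg (mul_nonneg (mul_nonneg (hCβ β) (S.cutH_nonneg β ζ)) (Real.rpow_nonneg (hlen y).le _))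
        (Real.rpow_nonneg (hlen y').le _)
    exact (hhol β ζ y y' h0 h1 hζ).trans (mul_le_mul_of_nonneg_left hexp hpre)

end OneMember

end

end Literature.MathematicalPhysics.QuantumFieldTheory.Balaban1983to89.B9Thm312WholeH
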